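import Mathlib
import HarnessLib
import Summits.HubbardSuperconductivity.HubbardSuperconductivity.Theorems.KLProgrammeKLRegimeCountertermFrameExtGWiggle

/-!
# Route `KLProgramme`, crux K3 (stmt-HubbardSuperconductivity-19937) — the polar angle of a ray point and the wiggle inequality READ ON A RAY:
# `f(polarAngle (t·dir θ)) = f(θ)` for `2π`-periodic `f`, `‖t·dir θ‖_ℂ = t`, and
# `|(klFrameExtG L μ f)(t·dir θ) − f(θ)| ≤ Λ_K·2π/L + Λ_f·π·(2π/L)/r` for a point `t·dir θ` of the level curve `{ε₀ = μ + κ}`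

Cell gate-hubbard-kl, seat p1b (g4).  The form in which child 2 (`KLRegimeCountertermV9/V10`, stmt-…-19664) applies
`abs_eval_klFrameExtG_sub_le` (`…CountertermFrameExtGWiggle`): at the frame's Fermi point `klFermiPoint μ K θ = u_K(θ)·dir θ`.
Proofs only; nothing is asserted about the model.
-/

noncomputable section

namespace Summit.HubbardSuperconductivity.HubbardSuperconductivity.Theorems.KLRegimeSplit

set_option linter.dupNamespace false -- summit = problem name (single-conjunct summit), D-0017

open Real Literature.MathematicalPhysics.QuantumLattice Literature.Probability.LatticeModels
open Literature.MathematicalPhysics.QuantumLattice.BandSectorCounting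

/-- `momToComplex (t·dir θ) = t·(cos θ + i sin θ)`. -/
theorem momToComplex_smul_dir (t θ : ℝ) :
    momToComplex (t • dir θ) = (t : ℂ) * (Complex.cos θ + Complex.sin θ * Complex.I) := by
  apply Complex.ext <;> simp [dir, smul_eq_mul, Complex.cos_ofReal_re, Complex.sin_ofReal_re, Complex.cos_ofReal_im,
    Complex.sin_ofReal_im]

/-- `‖t·dir θ‖_ℂ = t` for `t ≥ 0`. -/
theorem norm_momToComplex_smul_dir {t : ℝ} (ht : 0 ≤ t) (θ : ℝ) : ‖momToComplex (t • dir θ)‖ = t := by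
  rw [momToComplex_smul_dir, norm_mul, Complex.norm_real, Real.norm_eq_abs, abs_of_nonneg ht]
  have h : ‖Complex.cos (θ : ℂ) + Complex.sin (θ : ℂ) * Complex.I‖ = 1 := by
    rw [← Complex.exp_mul_I, Complex.norm_exp_ofReal_mul_I]
  rw [h, mul_one]

/-- **The polar angle of a ray point is the ray's angle modulo `2π`**: `polarAngle (t·dir θ) = θ + 2πm` for some integer `m` (`t > 0`). -/
theorem exists_polarAngle_smul_dir {t : ℝ} (ht : 0 < t) (θ : ℝ) : ∃ m : ℤ, polarAngle (t • dir θ) = θ + m * (2 * π) := by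
  refine ⟨⌊(π - θ) / (2 * π)⌋, ?_⟩
  unfold polarAngle
  rw [momToComplex_smul_dir]
  have h := Complex.arg_mul_cos_add_sin_mul_I_sub ht θ
  linarith

/-- **A `2π`-periodic function of the polar angle of a ray point is its value at the ray's angle**: `f(polarAngle (t·dir θ)) = f θ`. -/
theorem apply_polarAngle_smul_dir {f : ℝ → ℝ} (hper : Function.Periodic f (2 * π)) {t : ℝ} (ht : 0 < t) (θ : ℝ) :
    f (polarAngle (t • dir θ)) = f θ := by
  obtain ⟨m, hm⟩ := exists_polarAngle_smul_dir ht θ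
  rw [hm]
  exact hper.int_mul m θ

/-- **THE WIGGLE INEQUALITY ON A RAY.**  For `K = klFrameExtG L μ f` (`f` `2π`-periodic, even, quarter-turn invariant, `Λ_f`-Lipschitz;
`K` `Λ_K`-Lipschitz in the sup metric), `μ ≤ −1/10`, and a ray point `q = t·dir θ` of the level curve `{ε₀ = μ + κ}` with `|κ| ≤ klFlatR/2`,
seam margin `|qᵢ| ≤ π − 2π/L`, `8π/klFlatR ≤ L` and `2π/L < r ≤ t`:  `|K(t·dir θ) − f θ| ≤ Λ_K·2π/L + Λ_f·π·(2π/L)/r`.  (At the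
frame's Fermi point, `t = u_K(θ)`, `κ = K(q)`, `f = K∘k_F − ν_N(K)`: the left side is `|ν_N(K)(θ)|`.) -/
theorem abs_eval_klFrameExtG_smul_dir_sub_le (L : ℕ) [NeZero L] {μ : ℝ} (hμ : μ ≤ -(1 / 10)) {f : ℝ → ℝ}
    (hper : Function.Periodic f (2 * π)) (heven : ∀ θ, f (-θ) = f θ) (hquart : ∀ θ, f (θ + π / 2) = f θ) {Λf : ℝ}
    (hΛf : 0 ≤ Λf) (hLipf : ∀ a b, |f a - f b| ≤ Λf * |a - b|) {ΛK : ℝ} (hΛK : 0 ≤ ΛK)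
    (hLipK : ∀ p p' : Fin 2 → ℝ, |(klFrameExtG L μ f).eval p - (klFrameExtG L μ f).eval p'| ≤ ΛK * (|p 0 - p' 0| + |p 1 - p' 1|))
    {t θ : ℝ} (hq : ∀ i, |(t • dir θ) i| ≤ π - 2 * π / L) {κ : ℝ} (hε : eps2 ((t • dir θ) 0) ((t • dir θ) 1) = μ + κ)
    (hκ : |κ| ≤ klFlatR / 2) (hL : 8 * π / klFlatR ≤ L) {r : ℝ} (hr : 2 * π / L < r) (hrt : r ≤ t) :
    |(klFrameExtG L μ f).eval (t • dir θ) - f θ| ≤ ΛK * (2 * π / L) + Λf * π * (2 * (π / L) / r) := by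
  have hLpos : (0 : ℝ) < L := Nat.cast_pos.2 (Nat.pos_of_ne_zero (NeZero.ne L))
  have ht : 0 < t := lt_of_lt_of_le (lt_trans (by positivity) hr) hrt
  have hrq : r ≤ ‖momToComplex (t • dir θ)‖ := by rw [norm_momToComplex_smul_dir ht.le]; exact hrt
  have h := abs_eval_klFrameExtG_sub_le L hμ hper heven hquart hΛf hLipf hΛK hLipK hq hε hκ hL hr hrq
  rwa [apply_polarAngle_smul_dir hper ht] at h

end Summit.HubbardSuperconductivity.HubbardSuperconductivity.Theorems.KLRegimeSplit

end
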